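import Mathlib
import Literature.Probability.Process.PointStationaryLaw
import HarnessLib

/-!
# Crux `IsometryAtoms.MinimisingLawsHaveAtoms` (stmt-AtomisticToContinuum-15776), line
# `IdeatorOneSketch` — stub S5 `stub_locallyRigid_of`: the GENERIC EXACT LOCAL THEOREM

For a template `Y ∋ 0` in Euclidean 3-space that is

* HOMOGENEOUS (every point `p ∈ Y` is carried to the origin by a linear isometry `B` with
  `q ∈ Y ↔ p + B q ∈ Y`),
* LINEARLY PATCH-RIGID at radius `R₁` (a linear isometry equivalence mapping the patch
  `Y ∩ B̄(0, R₁)` onto itself maps `Y` onto itself),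
* STEP-CONNECTED from `0` at step `ρ` inside `Y`, and
* `R₀`-COVERING,

with `R₁ + ρ ≤ R₀`, every point set `S ∋ 0` all of whose points `x` have an EXACT
`Y`-environment of radius `R₀` (the counting measure of `S − x` agrees on `B̄(0, R₀)` with that
of a rooted isometric copy `A(Y − q)`, `q ∈ Y`) is itself such a rooted copy:
`count|S = count|A(Y − q)`.

Proof (a "local theorem" in the style of Delone–Dolbilin–Shtogrin–Galiulin, here with exact
environments so that no group stabilisation is needed); the helpers are stated for a real normed
space `F`:

1. measures ↔ sets (`inter_eq_of_count_restrict_eq`): two counting measures agreeing on a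
   measurable set `B` have the same points in `B`;
2. homogeneity turns every rooted copy `A(Y − q)` into `g '' Y` for a linear isometry
   EQUIVALENCE `g` (`image_sub_const_eq_image`, `rooted_image_eq`,
   `LinearIsometry.toLinearIsometryEquiv`), so exactness of `S` at `x` reads
   `∀ z, ‖z‖ ≤ R₀ → (z + x ∈ S ↔ z ∈ g '' Y)` (`exact_pointwise`);
3. normalise the root: with `g₀` the equivalence at `0 ∈ S`, the set `S' := g₀ ⁻¹' S` agrees
   with `Y` on `B̄(0, R₀)` and is again exact at every point (`exact_preimage`);
4. induction along the step graph (`agree_step`): agreement of `S'` and `Y` on `B̄(y, R₀)` gives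
   agreement on `B̄(y', R₁)` for `dist y y' ≤ ρ`; exactness at `y'` and patch rigidity
   (transported from `y'` to `0` by homogeneity) upgrade it to `B̄(y', R₀)`;
5. covering: every point of space is `R₀`-close to some `y ∈ Y`, where `S'` and `Y` agree, so
   `S' = Y` (`eq_of_agree_of_exact`) and `S = g₀ '' Y` is the rooted copy `(g₀, q := 0)`.
-/

noncomputable section

open MeasureTheory Set Metric

namespace Summit.AtomisticToContinuum.Crystallization.Theorems.IsometryAtomsMinimisingLawsHaveAtoms

/-! ### Small set-theoretic helpers -/

/-- Membership in a translate: `z ∈ S − y ↔ z + y ∈ S`. [folklore] -/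
theorem mem_image_sub_const_iff {G : Type*} [AddGroup G] {T : Set G} {y z : G} :
    z ∈ (fun s => s - y) '' T ↔ z + y ∈ T := by
  constructor
  · rintro ⟨s, hs, rfl⟩
    simpa using hs
  · intro h
    exact ⟨z + y, h, by simp⟩

/-- **Measures ↔ sets.** Two counting measures `count|S`, `count|T` that agree after restriction
to a measurable set `B` have the same points in `B`: `B ∩ S = B ∩ T` (evaluate at singletons).
[folklore] -/
theorem inter_eq_of_count_restrict_eq {α : Type*} [MeasurableSpace α]
    [MeasurableSingletonClass α] {S T B : Set α} (hB : MeasurableSet B)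
    (h : ((Measure.count : Measure α).restrict S).restrict B =
      ((Measure.count : Measure α).restrict T).restrict B) :
    B ∩ S = B ∩ T := by
  rw [Measure.restrict_restrict hB, Measure.restrict_restrict hB] at h
  ext x
  rw [← Literature.Probability.Process.count_restrict_singleton_ne_zero_iff (B ∩ S) x, h,
    Literature.Probability.Process.count_restrict_singleton_ne_zero_iff]

/-- **Homogeneity as an image.** If the linear isometry equivalence `B` carries `Y` to `Y − p`
pointwise (`q ∈ Y ↔ p + B q ∈ Y`), then `Y − p = B '' Y`. [folklore] -/
theorem image_sub_const_eq_image {F : Type*} [NormedAddCommGroup F] [NormedSpace ℝ F]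
    {Y : Set F} {p : F} (B : F ≃ₗᵢ[ℝ] F) (hB : ∀ q, q ∈ Y ↔ p + B q ∈ Y) :
    (fun s => s - p) '' Y = B '' Y := by
  ext z
  rw [mem_image_sub_const_iff]
  constructor
  · intro hz
    refine ⟨B.symm z, ?_, by simp⟩
    rw [hB, B.apply_symm_apply, add_comm]
    exact hz
  · rintro ⟨q, hq, rfl⟩
    rw [add_comm]
    exact (hB q).1 hq

/-- **Rooted copies are images under linear isometry equivalences.** With `B` the homogeneity
isometry at `q ∈ Y`, the rooted copy `A(Y − q)` is the image of `Y` under the equivalence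
`A ∘ B` (a linear isometry of a finite-dimensional space is an equivalence). [folklore] -/
theorem rooted_image_eq {F : Type*} [NormedAddCommGroup F] [NormedSpace ℝ F]
    [FiniteDimensional ℝ F] (A : F →ₗᵢ[ℝ] F) (B : F ≃ₗᵢ[ℝ] F) {Y : Set F} {q : F}
    (hB : ∀ r, r ∈ Y ↔ q + B r ∈ Y) :
    (fun s => A (s - q)) '' Y = (B.trans (A.toLinearIsometryEquiv rfl)) '' Y := by
  have hcomp : (fun s => A (s - q)) = A ∘ (fun s => s - q) := rfl
  rw [hcomp, Set.image_comp, image_sub_const_eq_image B hB, Set.image_image]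
  refine Set.image_congr fun x _ => ?_
  simp [LinearIsometryEquiv.trans_apply]

/-! ### Exactness in pointwise form -/

/-- **Exactness, pointwise.** If `T − x` and `V` have the same points in `B̄(0, R)`, then for
`‖z‖ ≤ R`: `z + x ∈ T ↔ z ∈ V`. [folklore] -/
theorem exact_pointwise {F : Type*} [NormedAddCommGroup F] {T V : Set F} {x : F} {R : ℝ}
    (h : closedBall (0 : F) R ∩ (fun s => s - x) '' T = closedBall (0 : F) R ∩ V) :
    ∀ z : F, ‖z‖ ≤ R → (z + x ∈ T ↔ z ∈ V) := by
  intro z hz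
  have h1 := Set.ext_iff.1 h z
  rw [mem_inter_iff, mem_inter_iff, mem_closedBall_zero_iff, mem_image_sub_const_iff] at h1
  exact ⟨fun h' => (h1.1 ⟨hz, h'⟩).2, fun h' => (h1.2 ⟨hz, h'⟩).2⟩

/-- **Normalising the root keeps exactness.** If every point `x` of `S` is exact at radius `R₀`
(`z + x ∈ S ↔ z ∈ g '' Y` on `‖z‖ ≤ R₀` for some linear isometry equivalence `g`), then so is
every point of `g₀ ⁻¹' S`. [folklore] -/
theorem exact_preimage {F : Type*} [NormedAddCommGroup F] [NormedSpace ℝ F] {Y S : Set F} {R₀ : ℝ}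
    (g₀ : F ≃ₗᵢ[ℝ] F)
    (hexact : ∀ x ∈ S, ∃ g : F ≃ₗᵢ[ℝ] F, ∀ z : F, ‖z‖ ≤ R₀ → (z + x ∈ S ↔ z ∈ g '' Y)) :
    ∀ x ∈ g₀ ⁻¹' S, ∃ g : F ≃ₗᵢ[ℝ] F,
      ∀ z : F, ‖z‖ ≤ R₀ → (z + x ∈ g₀ ⁻¹' S ↔ z ∈ g '' Y) := by
  intro x hx
  obtain ⟨g, hg⟩ := hexact (g₀ x) hx
  refine ⟨g.trans g₀.symm, fun z hz => ?_⟩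
  rw [mem_preimage, map_add, hg (g₀ z) (by rwa [g₀.norm_map])]
  constructor
  · rintro ⟨r, hr, hrz⟩
    exact ⟨r, hr, by simp [LinearIsometryEquiv.trans_apply, hrz]⟩
  · rintro ⟨r, hr, hrz⟩
    refine ⟨r, hr, ?_⟩
    have h1 := congrArg g₀ hrz
    simpa [LinearIsometryEquiv.trans_apply] using h1

/-! ### The induction step and the core of the local theorem -/

/-- **Induction step along the step graph.** If `S'` and `Y` agree on `B̄(y, R₀)`, `y' ∈ Y` with
`dist y y' ≤ ρ`, `S'` is exact at every point at radius `R₀`, `Y` is homogeneous and linearly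
patch-rigid at radius `R₁`, and `R₁ + ρ ≤ R₀`, then `y' ∈ S'` and `S'`, `Y` agree on
`B̄(y', R₀)`: agreement on `B̄(y', R₁) ⊆ B̄(y, R₀)` plus exactness at `y'` make the patch of the
copy `g '' Y` at `y'` coincide with that of `Y − y' = B '' Y` (`B` the homogeneity isometry at
`y'`), and patch rigidity for `B⁻¹ ∘ g` identifies the whole copy with `Y − y'`. [folklore] -/
theorem agree_step {F : Type*} [NormedAddCommGroup F] [NormedSpace ℝ F] {Y S' : Set F}
    {R₀ R₁ ρ : ℝ} {y y' : F} (hR₁ : 0 ≤ R₁) (hρ : 0 ≤ ρ) (hR : R₁ + ρ ≤ R₀)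
    (hhom : ∀ p ∈ Y, ∃ B : F ≃ₗᵢ[ℝ] F, ∀ q, q ∈ Y ↔ p + B q ∈ Y)
    (hrig : ∀ f : F ≃ₗᵢ[ℝ] F,
      f '' Y ∩ closedBall (0 : F) R₁ = Y ∩ closedBall (0 : F) R₁ → f '' Y = Y)
    (hexact : ∀ x ∈ S', ∃ g : F ≃ₗᵢ[ℝ] F,
      ∀ z : F, ‖z‖ ≤ R₀ → (z + x ∈ S' ↔ z ∈ g '' Y))
    (hSy : ∀ w, dist w y ≤ R₀ → (w ∈ S' ↔ w ∈ Y)) (hy' : y' ∈ Y) (hd : dist y y' ≤ ρ) :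
    y' ∈ S' ∧ ∀ w, dist w y' ≤ R₀ → (w ∈ S' ↔ w ∈ Y) := by
  have hy'S : y' ∈ S' := (hSy y' (by rw [dist_comm]; linarith)).2 hy'
  -- agreement on the smaller ball `B̄(y', R₁) ⊆ B̄(y, R₀)`
  have hR₁agree : ∀ w, dist w y' ≤ R₁ → (w ∈ S' ↔ w ∈ Y) := fun w hw =>
    hSy w (by linarith [dist_triangle w y' y, dist_comm y y'])
  obtain ⟨g, hg⟩ := hexact y' hy'S
  obtain ⟨B, hB⟩ := hhom y' hy'
  -- the patch of `B⁻¹ g Y` is the patch of `Y`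
  have hf : (g.trans B.symm) '' Y ∩ closedBall (0 : F) R₁ = Y ∩ closedBall (0 : F) R₁ := by
    ext q
    simp only [mem_inter_iff, mem_closedBall_zero_iff]
    constructor
    · rintro ⟨⟨r, hr, hrq⟩, hqn⟩
      refine ⟨?_, hqn⟩
      have hBq : B q = g r := by
        rw [← hrq]
        simp [LinearIsometryEquiv.trans_apply]
      have h1 : B q ∈ g '' Y := hBq ▸ mem_image_of_mem g hr
      have h2 : ‖B q‖ ≤ R₀ := by
        rw [B.norm_map]
        linarith
      have h3 : B q + y' ∈ S' := (hg (B q) h2).2 h1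
      have h4 : B q + y' ∈ Y :=
        (hR₁agree _ (by rw [dist_eq_norm, add_sub_cancel_right, B.norm_map]; exact hqn)).1 h3
      rw [hB q, add_comm]
      exact h4
    · rintro ⟨hq, hqn⟩
      refine ⟨?_, hqn⟩
      have h2 : ‖B q‖ ≤ R₀ := by
        rw [B.norm_map]
        linarith
      have h4 : B q + y' ∈ Y := by
        rw [add_comm]
        exact (hB q).1 hq
      have h3 : B q + y' ∈ S' :=
        (hR₁agree _ (by rw [dist_eq_norm, add_sub_cancel_right, B.norm_map]; exact hqn)).2 h4
      obtain ⟨r, hr, hrq⟩ := (hg (B q) h2).1 h3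
      exact ⟨r, hr, by simp [LinearIsometryEquiv.trans_apply, hrq]⟩
  have hfY : (g.trans B.symm) '' Y = Y := hrig _ hf
  -- hence the copy at `y'` is `Y − y'`
  have hgY : ∀ w, w ∈ g '' Y ↔ w + y' ∈ Y := by
    intro w
    constructor
    · rintro ⟨r, hr, rfl⟩
      have h1 : (g.trans B.symm) r ∈ Y := by
        rw [← hfY]
        exact mem_image_of_mem _ hr
      have h2 := (hB (B.symm (g r))).1 (by simpa [LinearIsometryEquiv.trans_apply] using h1)
      rwa [B.apply_symm_apply, add_comm] at h2
    · intro hw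
      have h1 : B.symm w ∈ Y := by
        rw [hB, B.apply_symm_apply, add_comm]
        exact hw
      rw [← hfY] at h1
      obtain ⟨r, hr, hrw⟩ := h1
      refine ⟨r, hr, ?_⟩
      have h2 := congrArg B hrw
      simpa [LinearIsometryEquiv.trans_apply] using h2
  refine ⟨hy'S, fun w hw => ?_⟩
  have hz : ‖w - y'‖ ≤ R₀ := by rwa [← dist_eq_norm]
  have h1 := hg (w - y') hz
  rw [sub_add_cancel] at h1
  rw [h1, hgY, sub_add_cancel]

/-- **Core of the local theorem.** If `S'` agrees with `Y` on `B̄(0, R₀)` and is exact at every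
point at radius `R₀`, and `Y ∋ 0` is homogeneous, linearly patch-rigid at radius `R₁`,
step-connected from `0` at step `ρ` and `R₀`-covering with `R₁ + ρ ≤ R₀`, then `S' = Y`:
induction along the step graph gives agreement on `B̄(y, R₀)` for every `y ∈ Y`, and these balls
cover space. [folklore] -/
theorem eq_of_agree_of_exact {F : Type*} [NormedAddCommGroup F] [NormedSpace ℝ F] {Y S' : Set F}
    {R₀ R₁ ρ : ℝ} (hR₁ : 0 ≤ R₁) (hρ : 0 ≤ ρ) (hR : R₁ + ρ ≤ R₀) (hY0 : (0 : F) ∈ Y)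
    (hhom : ∀ p ∈ Y, ∃ B : F ≃ₗᵢ[ℝ] F, ∀ q, q ∈ Y ↔ p + B q ∈ Y)
    (hrig : ∀ f : F ≃ₗᵢ[ℝ] F,
      f '' Y ∩ closedBall (0 : F) R₁ = Y ∩ closedBall (0 : F) R₁ → f '' Y = Y)
    (hconn : ∀ p ∈ Y,
      Relation.ReflTransGen (fun x y : F => x ∈ Y ∧ y ∈ Y ∧ dist x y ≤ ρ) 0 p)
    (hcov : ∀ z : F, ∃ y ∈ Y, dist z y ≤ R₀)
    (h0 : ∀ w, dist w (0 : F) ≤ R₀ → (w ∈ S' ↔ w ∈ Y))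
    (hexact : ∀ x ∈ S', ∃ g : F ≃ₗᵢ[ℝ] F,
      ∀ z : F, ‖z‖ ≤ R₀ → (z + x ∈ S' ↔ z ∈ g '' Y)) :
    S' = Y := by
  have key : ∀ p, Relation.ReflTransGen (fun x y : F => x ∈ Y ∧ y ∈ Y ∧ dist x y ≤ ρ) 0 p →
      p ∈ S' ∧ ∀ w, dist w p ≤ R₀ → (w ∈ S' ↔ w ∈ Y) := by
    intro p hp
    induction hp with
    | refl => exact ⟨(h0 0 (by rw [dist_self]; linarith)).2 hY0, h0⟩
    | tail _ hbc ih => exact agree_step hR₁ hρ hR hhom hrig hexact ih.2 hbc.2.1 hbc.2.2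
  ext w
  obtain ⟨y, hy, hwy⟩ := hcov w
  exact (key y (hconn y hy)).2 w hwy

/-! ### The registered stub -/

/-- **STUB S5 — generic exact local theorem.** For a template `Y ∋ 0` of Euclidean 3-space that
is homogeneous (every point is carried to the origin by a linear isometry preserving `Y`),
linearly patch-rigid at radius `R₁`, step-connected from `0` at step `ρ`, and `R₀`-covering,
with `R₁ + ρ ≤ R₀`: every point set `S ∋ 0` all of whose points `x` have an exact
`Y`-environment of radius `R₀` (the counting measure of `S − x` agrees on `B̄(0, R₀)` with that
of a rooted isometric copy `A(Y − q)`, `q ∈ Y`) is itself such a rooted copy,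
`count|S = count|A(Y − q)`. Proof: normalise the root's copy to `Y` (`exact_preimage`), induct
along the step graph (`agree_step`), finish by covering (`eq_of_agree_of_exact`). [folklore] -/
theorem stub_locallyRigid_of : ∀ (Y : Set (EuclideanSpace ℝ (Fin 3))) (R₀ R₁ ρ : ℝ),
    0 ≤ R₁ → 0 ≤ ρ → R₁ + ρ ≤ R₀ → (0 : EuclideanSpace ℝ (Fin 3)) ∈ Y →
    (∀ p ∈ Y, ∃ B : EuclideanSpace ℝ (Fin 3) ≃ₗᵢ[ℝ] EuclideanSpace ℝ (Fin 3),
      ∀ q, q ∈ Y ↔ p + B q ∈ Y) →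
    (∀ f : EuclideanSpace ℝ (Fin 3) ≃ₗᵢ[ℝ] EuclideanSpace ℝ (Fin 3),
      f '' Y ∩ Metric.closedBall (0 : EuclideanSpace ℝ (Fin 3)) R₁ =
        Y ∩ Metric.closedBall (0 : EuclideanSpace ℝ (Fin 3)) R₁ → f '' Y = Y) →
    (∀ p ∈ Y, Relation.ReflTransGen
      (fun x y : EuclideanSpace ℝ (Fin 3) => x ∈ Y ∧ y ∈ Y ∧ dist x y ≤ ρ) 0 p) →
    (∀ z : EuclideanSpace ℝ (Fin 3), ∃ y ∈ Y, dist z y ≤ R₀) →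
    ∀ S : Set (EuclideanSpace ℝ (Fin 3)), (0 : EuclideanSpace ℝ (Fin 3)) ∈ S →
      (∀ x ∈ S, ∃ ν ∈ {μ : Measure (EuclideanSpace ℝ (Fin 3)) |
          ∃ A : EuclideanSpace ℝ (Fin 3) →ₗᵢ[ℝ] EuclideanSpace ℝ (Fin 3), ∃ q ∈ Y,
            μ = (Measure.count : Measure (EuclideanSpace ℝ (Fin 3))).restrict
              ((fun s => A (s - q)) '' Y)},
        ((Measure.count : Measure (EuclideanSpace ℝ (Fin 3))).restrict
            ((fun s => s - x) '' S)).restrict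
            (Metric.closedBall (0 : EuclideanSpace ℝ (Fin 3)) R₀) =
          ν.restrict (Metric.closedBall (0 : EuclideanSpace ℝ (Fin 3)) R₀)) →
      (Measure.count : Measure (EuclideanSpace ℝ (Fin 3))).restrict S ∈
        {μ : Measure (EuclideanSpace ℝ (Fin 3)) |
          ∃ A : EuclideanSpace ℝ (Fin 3) →ₗᵢ[ℝ] EuclideanSpace ℝ (Fin 3), ∃ q ∈ Y,
            μ = (Measure.count : Measure (EuclideanSpace ℝ (Fin 3))).restrict
              ((fun s => A (s - q)) '' Y)} := by
  intro Y R₀ R₁ ρ hR₁ hρ hR hY0 hhom hrig hconn hcov S hS0 hex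
  -- exactness of `S` at every point, in pointwise form with linear isometry equivalences
  have hexact : ∀ x ∈ S, ∃ g : EuclideanSpace ℝ (Fin 3) ≃ₗᵢ[ℝ] EuclideanSpace ℝ (Fin 3),
      ∀ z, ‖z‖ ≤ R₀ → (z + x ∈ S ↔ z ∈ g '' Y) := by
    intro x hx
    obtain ⟨ν, hν, hνx⟩ := hex x hx
    obtain ⟨A, q, hq, rfl⟩ := hν
    obtain ⟨B, hB⟩ := hhom q hq
    refine ⟨B.trans (A.toLinearIsometryEquiv rfl), ?_⟩
    have hset := inter_eq_of_count_restrict_eq measurableSet_closedBall hνx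
    rw [rooted_image_eq A B hB] at hset
    exact exact_pointwise hset
  -- normalise the root: `g₀ ⁻¹' S` agrees with `Y` on `B̄(0, R₀)` and stays exact
  obtain ⟨g₀, hg₀⟩ := hexact 0 hS0
  have h0 : ∀ w, dist w (0 : EuclideanSpace ℝ (Fin 3)) ≤ R₀ → (w ∈ g₀ ⁻¹' S ↔ w ∈ Y) := by
    intro w hw
    rw [dist_zero_right] at hw
    have h1 := hg₀ (g₀ w) (by rwa [g₀.norm_map])
    rw [add_zero, g₀.injective.mem_set_image] at h1
    exact h1
  -- the core: `g₀ ⁻¹' S = Y`, so `S = g₀ '' Y` is the rooted copy `(g₀, 0)`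
  have hS' : g₀ ⁻¹' S = Y :=
    eq_of_agree_of_exact hR₁ hρ hR hY0 hhom hrig hconn hcov h0 (exact_preimage g₀ hexact)
  have hS : S = g₀ '' Y := by rw [← hS', Set.image_preimage_eq S g₀.surjective]
  subst hS
  refine ⟨g₀.toLinearIsometry, 0, hY0, ?_⟩
  simp

end Summit.AtomisticToContinuum.Crystallization.Theorems.IsometryAtomsMinimisingLawsHaveAtoms

end
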